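import Summits.AtomisticToContinuum.Crystallization.Theorems.SquareWellLayerCakeTwelveWithinOneReturn

/-!
# Crux `GappedShellCensus.RadialDefectsVanish` (stmt-AtomisticToContinuum-15930), line `palm-pinned-scale`:
# `stub_returnRadial` — from the measure-level radial predicate with slack to the crux's count

FROM MEASURE-LEVEL GAPPED-TWELVE WITH SLACK TO THE CRUX AT THE PINNED SCALE `a₀ = 50/51`.  If every
minimising point-stationary hard-core law on rooted configurations of `ℝ³` satisfies, almost surely,
[all atoms pairwise `(55/57 + σ)`-separated ∧ every atom `w ≠ 0` has `‖w‖ ≤ 1 − σ` or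
`‖w‖ ≥ 21/17 + σ` ∧ the atoms `w ≠ 0` of norm `≤ 1 − σ` are exactly twelve] (`σ > 0`), and
Lennard-Jones ground states have Benjamini–Schramm limits (density-transfer form) along every
prescribed subsequence, then for every sequence of ground states the fraction of particles that are
NOT gapped-twelve at scale `50/51` (twelve others within `50/51·(1 + 1/50) = 1`, none closer than
`50/51·(1 − 1/50) = 49/51`, none in the open annulus `(1, 50/51·63/50) = (1, 21/17)`) tends to `0`.

Proof = the landed `SquareWellLayerCakeTwelveWithinOne.stub_return` (portmanteau with slack along
subsequences, `false_of_counts`) with its matching lemma replaced by `radialGood_of_matched`: the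
particles within `1` of a matched particle inject into the twelve shell atoms (an atom within `1 + ε`
of the root is the root or a shell atom, by the gap; two particles on one atom are `2ε < δₓ` apart),
and the twelve shell atoms are hit by twelve distinct particles within `1 − σ + ε ≤ 1`; a particle
closer than `49/51` would sit on an atom of norm `< 55/57 + σ`, i.e. on the root; a particle at
distance in `(1, 21/17)` would sit on an atom of norm in `(1 − σ, 21/17 + σ)`, excluded.
-/

noncomputable section

open MeasureTheory Filter Set
open scoped ENNReal Topology

namespace Summit.AtomisticToContinuum.Crystallization.Theorems.RadialDefectsVanishPalmPinnedScale

open Literature.MathematicalPhysics.StatisticalMechanics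
open Summit.AtomisticToContinuum.Crystallization.Theorems.SquareWellLayerCakeTwelveWithinOne (false_of_counts)

local notation "E3" => EuclideanSpace ℝ (Fin 3)

/-- The three numerals of the crux's inline clause at the pinned scale `a₀ = 50/51`. [folklore] -/
theorem pinnedScale_numerals :
    (50 / 51 * (1 + 1 / 50) : ℝ) = 1 ∧ (50 / 51 * (1 - 1 / 50) : ℝ) = 49 / 51 ∧
      (50 / 51 * (63 / 50) : ℝ) = 21 / 17 := by
  norm_num

/-- **The matching claim (deterministic geometry).** Let `y` be a `δₓ`-separated configuration, `i`
an index, and `S ∋ 0` a set of atoms which is pairwise `(55/57 + σ)`-separated, radially gapped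
(every atom `w ≠ 0` has `‖w‖ ≤ 1 − σ` or `‖w‖ ≥ 21/17 + σ`) and whose atoms `w ≠ 0` of norm
`≤ 1 − σ` form a twelve-element finset `T`.  If the recentred configuration `k ↦ y k - y i` and `S`
are `ε`-matched within radius `3` with `2ε ≤ σ`, `2ε < δₓ`, then `i` is gapped-twelve at the pinned
scale: exactly twelve `j ≠ i` within distance `1`, all `j ≠ i` at distance `≥ 49/51`, and every
`j ≠ i` at distance `≤ 1` or `≥ 21/17`. [folklore] -/
theorem radialGood_of_matched {N : ℕ} (y : Fin N → E3) (i : Fin N)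
    {σ δₓ ε : ℝ} (hε : 0 < ε) (hεσ : 2 * ε ≤ σ) (hεδₓ : 2 * ε < δₓ)
    (hsepy : ∀ j k : Fin N, j ≠ k → δₓ ≤ dist (y j) (y k))
    (S : Set E3) (h0 : (0 : E3) ∈ S)
    (hsep : ∀ w ∈ S, ∀ w' ∈ S, w ≠ w' → 55 / 57 + σ ≤ dist w w')
    (hgap : ∀ w ∈ S, w ≠ 0 → (‖w‖ ≤ 1 - σ ∨ 21 / 17 + σ ≤ ‖w‖))
    (T : Finset E3) (hT12 : T.card = 12) (hT : ∀ w ∈ T, w ∈ S ∧ w ≠ 0 ∧ ‖w‖ ≤ 1 - σ)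
    (hTall : ∀ w ∈ S, w ≠ 0 → ‖w‖ ≤ 1 - σ → w ∈ T)
    (ha : ∀ p ∈ S, ‖p‖ ≤ 3 → ∃ k : Fin N, dist (y k - y i) p ≤ ε)
    (hb : ∀ k : Fin N, ‖y k - y i‖ ≤ 3 → ∃ p ∈ S, dist (y k - y i) p ≤ ε) :
    (Finset.univ.filter fun j : Fin N => j ≠ i ∧ dist (y i) (y j) ≤ 1).card = 12 ∧
      ∀ j : Fin N, j ≠ i → (49 : ℝ) / 51 ≤ dist (y i) (y j) ∧
        (dist (y i) (y j) ≤ 1 ∨ (21 : ℝ) / 17 ≤ dist (y i) (y j)) := by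
  classical
  -- an atom within `ε` of a recentred particle `j ≠ i` is not the root
  have hne0 : ∀ j : Fin N, j ≠ i → ∀ p : E3, dist (y j - y i) p ≤ ε → p ≠ 0 := by
    intro j hji p hp hp0
    rw [hp0, dist_zero_right, ← dist_eq_norm] at hp
    have := hsepy j i hji
    linarith
  -- a non-root atom has norm `≥ 55/57 + σ`
  have hfar0 : ∀ p ∈ S, p ≠ 0 → 55 / 57 + σ ≤ ‖p‖ := by
    intro p hp hp0
    rw [← dist_zero_right]
    exact hsep p hp 0 h0 hp0
  refine ⟨le_antisymm ?_ ?_, ?_⟩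
  · -- (≤ 12) the particles within `1` inject into `T`
    have hchoice : ∀ k : Fin N, ∃ p : E3, ‖y k - y i‖ ≤ 3 → p ∈ S ∧ dist (y k - y i) p ≤ ε := by
      intro k
      by_cases hk : ‖y k - y i‖ ≤ 3
      · obtain ⟨p, hpS, hp⟩ := hb k hk
        exact ⟨p, fun _ => ⟨hpS, hp⟩⟩
      · exact ⟨0, fun h => absurd h hk⟩
    choose pf hpf using hchoice
    rw [← hT12]
    refine Finset.card_le_card_of_injOn pf ?_ ?_
    · intro j hj
      have hj' := Finset.mem_filter.1 (Finset.mem_coe.1 hj)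
      obtain ⟨hji, hd⟩ := hj'.2
      have hn3 : ‖y j - y i‖ ≤ 3 := by rw [← dist_eq_norm, dist_comm]; linarith
      obtain ⟨hpS, hp⟩ := hpf j hn3
      have hp0 : pf j ≠ 0 := hne0 j hji (pf j) hp
      have hpn : ‖pf j‖ ≤ 1 + ε := by
        have h := dist_triangle (pf j) (y j - y i) 0
        rw [dist_zero_right, dist_zero_right, dist_comm (pf j), ← dist_eq_norm, dist_comm (y j)] at h
        linarith
      have hp1 : ‖pf j‖ ≤ 1 - σ := by
        rcases hgap (pf j) hpS hp0 with h | h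
        · exact h
        · exfalso
          have : (21 : ℝ) / 17 + σ ≤ 1 + ε := h.trans hpn
          linarith
      exact Finset.mem_coe.2 (hTall (pf j) hpS hp0 hp1)
    · intro j hj j' hj' hjj
      by_contra hne
      have hj1 := Finset.mem_filter.1 (Finset.mem_coe.1 hj)
      have hj2 := Finset.mem_filter.1 (Finset.mem_coe.1 hj')
      have hn3 : ‖y j - y i‖ ≤ 3 := by rw [← dist_eq_norm, dist_comm]; linarith [hj1.2.2]
      have hn3' : ‖y j' - y i‖ ≤ 3 := by rw [← dist_eq_norm, dist_comm]; linarith [hj2.2.2]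
      have hp := (hpf j hn3).2
      have hp' := (hpf j' hn3').2
      rw [hjj] at hp
      have h := dist_triangle (y j - y i) (pf j') (y j' - y i)
      rw [dist_sub_right, dist_comm (pf j') (y j' - y i)] at h
      have := hsepy j j' hne
      linarith
  · -- (≥ 12) the twelve shell atoms are hit by twelve distinct particles within `1`
    have hchoice : ∀ w : E3, ∃ k : Fin N, w ∈ T → dist (y k - y i) w ≤ ε := by
      intro w
      by_cases hw : w ∈ T
      · obtain ⟨hwS, -, hw1⟩ := hT w hw
        obtain ⟨k, hk⟩ := ha w hwS (by linarith)
        exact ⟨k, fun _ => hk⟩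
      · exact ⟨i, fun h => absurd h hw⟩
    choose kf hkf using hchoice
    rw [← hT12]
    refine Finset.card_le_card_of_injOn kf ?_ ?_
    · intro w hw
      have hwT : w ∈ T := Finset.mem_coe.1 hw
      obtain ⟨hwS, hw0, hw1⟩ := hT w hwT
      have hk := hkf w hwT
      refine Finset.mem_coe.2 (Finset.mem_filter.2 ⟨Finset.mem_univ _, ?_, ?_⟩)
      · intro hki
        rw [hki, sub_self, dist_comm, dist_zero_right] at hk
        have h := hfar0 w hwS hw0
        have hσε : ε < 55 / 57 + σ := by linarith
        linarith
      · rw [dist_comm, dist_eq_norm]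
        have h := dist_triangle (y (kf w) - y i) w 0
        rw [dist_zero_right, dist_zero_right] at h
        linarith
    · intro w hw w' hw' hkeq
      by_contra hne
      have h1 := hkf w (Finset.mem_coe.1 hw)
      have h2 := hkf w' (Finset.mem_coe.1 hw')
      rw [hkeq, dist_comm] at h1
      have h := hsep w (hT w (Finset.mem_coe.1 hw)).1 w' (hT w' (Finset.mem_coe.1 hw')).1 hne
      linarith [dist_triangle w (y (kf w') - y i) w']
  · -- radial window and gap for every `j ≠ i`
    intro j hji
    by_cases h3 : ‖y j - y i‖ ≤ 3
    · obtain ⟨p, hpS, hp⟩ := hb j h3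
      have hp0 : p ≠ 0 := hne0 j hji p hp
      have hpn := hfar0 p hpS hp0
      -- `|‖p‖ - dist (y i) (y j)| ≤ ε`
      have hup : ‖p‖ ≤ dist (y i) (y j) + ε := by
        have h := dist_triangle p (y j - y i) 0
        rw [dist_zero_right, dist_zero_right, dist_comm p, ← dist_eq_norm, dist_comm (y j)] at h
        linarith
      have hlo : dist (y i) (y j) ≤ ‖p‖ + ε := by
        have h := dist_triangle (y j - y i) p 0
        rw [dist_zero_right, dist_zero_right, ← dist_eq_norm, dist_comm (y j)] at h
        linarith
      refine ⟨?_, ?_⟩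
      · -- `49/51 < 55/57`, so a closer particle would sit on the root
        have h4951 : (49 : ℝ) / 51 + ε < 55 / 57 + σ := by
          have : (49 : ℝ) / 51 < 55 / 57 := by norm_num
          linarith
        linarith
      · by_contra hnot
        push Not at hnot
        obtain ⟨hgt1, hlt⟩ := hnot
        rcases hgap p hpS hp0 with h | h
        · linarith
        · linarith
    · -- far particles: distance `> 3 ≥ 21/17`
      rw [not_le, ← dist_eq_norm, dist_comm] at h3
      refine ⟨by linarith, Or.inr (by linarith)⟩

/-- The matching claim for a configuration MEASURE `ν = count|S`, with the predicate and the two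
matching clauses in the form delivered by the density transfer of the Benjamini–Schramm limit, and
the conclusion in the literal form of the crux's clause at `a := 50/51`. [folklore] -/
theorem radialGood_of_matched_measure {N : ℕ} (y : Fin N → E3) (i : Fin N)
    {σ δ δₓ ε : ℝ} (hε : 0 < ε) (hεσ : 2 * ε ≤ σ) (hεδₓ : 2 * ε < δₓ)
    (hsepy : ∀ j k : Fin N, j ≠ k → δₓ ≤ dist (y j) (y k))
    (ν : Measure E3)
    (hgood : (∀ w w' : E3, ν {w} ≠ 0 → ν {w'} ≠ 0 → w ≠ w' → 55 / 57 + σ ≤ dist w w') ∧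
      (∀ w : E3, ν {w} ≠ 0 → w ≠ 0 → (‖w‖ ≤ 1 - σ ∨ 21 / 17 + σ ≤ ‖w‖)) ∧
      ∃ T : Finset E3, T.card = 12 ∧ (∀ w ∈ T, ν {w} ≠ 0 ∧ w ≠ 0 ∧ ‖w‖ ≤ 1 - σ) ∧
        ∀ w : E3, ν {w} ≠ 0 → w ≠ 0 → ‖w‖ ≤ 1 - σ → w ∈ T)
    (hcore : ∃ S : Set E3, (0 : E3) ∈ S ∧ (∀ x ∈ S, ∀ y ∈ S, x ≠ y → δ ≤ dist x y) ∧
      ν = (Measure.count : Measure E3).restrict S)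
    (ha : ∀ p : E3, ν {p} ≠ 0 → ‖p‖ ≤ 3 → ∃ q ∈ (Set.range (fun k : Fin N => y k - y i)), dist q p ≤ ε)
    (hb : ∀ q ∈ (Set.range (fun k : Fin N => y k - y i)), ‖q‖ ≤ 3 → ∃ p : E3, ν {p} ≠ 0 ∧ dist q p ≤ ε) :
    (Finset.univ.filter fun j : Fin N => j ≠ i ∧ dist (y i) (y j) ≤ 50 / 51 * (1 + 1 / 50)).card = 12 ∧
      ∀ j : Fin N, j ≠ i → 50 / 51 * (1 - 1 / 50) ≤ dist (y i) (y j) ∧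
        (dist (y i) (y j) ≤ 50 / 51 * (1 + 1 / 50) ∨ 50 / 51 * (63 / 50) ≤ dist (y i) (y j)) := by
  obtain ⟨e1, e2, e3⟩ := pinnedScale_numerals
  simp only [e1, e2, e3]
  obtain ⟨S, h0, -, rfl⟩ := hcore
  simp only [Literature.Probability.Process.count_restrict_singleton_ne_zero_iff] at hgood ha hb
  obtain ⟨hsep, hgap, T, hT12, hT, hTall⟩ := hgood
  refine radialGood_of_matched y i hε hεσ hεδₓ hsepy S h0
    (fun w hw w' hw' hne => hsep w w' hw hw' hne) hgap T hT12 hT hTall ?_ ?_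
  · intro p hp hp3
    obtain ⟨q, ⟨k, rfl⟩, hq⟩ := ha p hp hp3
    exact ⟨k, hq⟩
  · intro k hk
    exact hb (y k - y i) ⟨k, rfl⟩ hk

/-- **`stub_returnRadial` (line `palm-pinned-scale`, crux `GappedShellCensus.RadialDefectsVanish`)** —
FROM THE MEASURE-LEVEL RADIAL PREDICATE WITH SLACK TO THE CRUX'S COUNT AT THE PINNED SCALE `50/51`:
subsequence contradiction via `radialGood_of_matched_measure` with `R = 3`,
`ε = min σ δₓ / 3`, and the landed `false_of_counts`. [folklore] -/
theorem stub_returnRadial :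
    ∀ σ : ℝ, 0 < σ →
    (∀ δ : ℝ, 0 < δ → ∀ P : Measure (Measure E3), IsProbabilityMeasure P →
      (∀ᵐ μ ∂P, (∃ S : Set E3, (0 : E3) ∈ S ∧ (∀ x ∈ S, ∀ y ∈ S, x ≠ y → δ ≤ dist x y) ∧
        μ = (Measure.count : Measure E3).restrict S)) →
      (∀ g : Measure E3 → E3 → ℝ≥0∞, Measurable (Function.uncurry g) →
        ∫⁻ μ, ∫⁻ y, g μ y ∂μ ∂P = ∫⁻ μ, ∫⁻ y, g (Measure.map (fun z => z - y) μ) (-y) ∂μ ∂P) →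
      (∫ μ, (∫ y, lennardJones ‖y‖ ∂μ) / 2 ∂P) ≤
        (⨅ Q : PeriodicConfiguration 3, Q.energyPerParticle lennardJones) →
      ∀ᵐ μ ∂P,
        (∀ w w' : E3, μ {w} ≠ 0 → μ {w'} ≠ 0 → w ≠ w' → 55 / 57 + σ ≤ dist w w') ∧
          (∀ w : E3, μ {w} ≠ 0 → w ≠ 0 → (‖w‖ ≤ 1 - σ ∨ 21 / 17 + σ ≤ ‖w‖)) ∧
          ∃ T : Finset E3, T.card = 12 ∧ (∀ w ∈ T, μ {w} ≠ 0 ∧ w ≠ 0 ∧ ‖w‖ ≤ 1 - σ) ∧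
            ∀ w : E3, μ {w} ≠ 0 → w ≠ 0 → ‖w‖ ≤ 1 - σ → w ∈ T) →
    (∀ x : (N : ℕ) → (Fin N → E3), (∀ N, IsGroundState lennardJones (x N)) →
      ∀ ψ : ℕ → ℕ, StrictMono ψ →
      ∃ φ : ℕ → ℕ, StrictMono φ ∧ ∃ δ : ℝ, 0 < δ ∧
        ∃ P : Measure (Measure E3), IsProbabilityMeasure P ∧
        (∀ᵐ μ ∂P, (∃ S : Set E3, (0 : E3) ∈ S ∧ (∀ x ∈ S, ∀ y ∈ S, x ≠ y → δ ≤ dist x y) ∧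
          μ = (Measure.count : Measure E3).restrict S)) ∧
        (∀ g : Measure E3 → E3 → ℝ≥0∞, Measurable (Function.uncurry g) →
          ∫⁻ μ, ∫⁻ y, g μ y ∂μ ∂P = ∫⁻ μ, ∫⁻ y, g (Measure.map (fun z => z - y) μ) (-y) ∂μ ∂P) ∧
        Filter.Tendsto (fun j : ℕ => groundStateEnergy lennardJones 3 (ψ (φ j)) / (ψ (φ j) : ℝ))
          Filter.atTop (nhds (∫ μ, (∫ y, lennardJones ‖y‖ ∂μ) / 2 ∂P)) ∧
        ∀ T : Set (Measure E3), ∀ R ε : ℝ, 0 < ε → ∀ ρ : ℝ, ρ < (P T).toReal →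
          ∀ᶠ j : ℕ in Filter.atTop, ρ * (ψ (φ j) : ℝ) ≤ (Nat.card {i : Fin (ψ (φ j)) // ∃ ν ∈ T,
            ((∀ p : E3, ν {p} ≠ 0 → ‖p‖ ≤ R →
                ∃ q ∈ (Set.range (fun k : Fin (ψ (φ j)) => x (ψ (φ j)) k - x (ψ (φ j)) i)), dist q p ≤ ε) ∧
              (∀ q ∈ (Set.range (fun k : Fin (ψ (φ j)) => x (ψ (φ j)) k - x (ψ (φ j)) i)), ‖q‖ ≤ R →
                ∃ p : E3, ν {p} ≠ 0 ∧ dist q p ≤ ε))} : ℝ)) →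
    ∀ x : (N : ℕ) → (Fin N → E3), (∀ N, IsGroundState lennardJones (x N)) →
      Filter.Tendsto (fun N : ℕ => (Nat.card {i : Fin N //
        ¬ ((Finset.univ.filter fun j : Fin N =>
              j ≠ i ∧ dist (x N i) (x N j) ≤ 50 / 51 * (1 + 1 / 50)).card = 12 ∧
            ∀ j : Fin N, j ≠ i → 50 / 51 * (1 - 1 / 50) ≤ dist (x N i) (x N j) ∧
              (dist (x N i) (x N j) ≤ 50 / 51 * (1 + 1 / 50) ∨
                50 / 51 * (63 / 50) ≤ dist (x N i) (x N j)))} : ℝ) / N)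
        Filter.atTop (nhds 0) := by
  intro σ hσ hLaws hBS x hx
  obtain ⟨δₓ, hδₓ, hsepx⟩ := LennardJonesMinimalDistance_holds
  rw [Metric.tendsto_nhds]
  intro η hη
  by_contra hnot
  -- a subsequence `ψ` along which the bad fraction stays `≥ η`
  obtain ⟨ψ, hψ, hψbad⟩ := Filter.extraction_of_frequently_atTop (Filter.not_eventually.1 hnot)
  -- the Benjamini–Schramm limit along `ψ ∘ φ`
  obtain ⟨φ, hφ, δ, hδ, P, hP, hcore, hstat, hE, htransfer⟩ := hBS x hx ψ hψ
  -- the limit law is minimising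
  have hlim : Filter.Tendsto (fun N : ℕ => groundStateEnergy lennardJones 3 N / (N : ℝ))
      Filter.atTop (𝓝 (⨅ Q : PeriodicConfiguration 3, Q.energyPerParticle lennardJones)) :=
    Summit.AtomisticToContinuum.Crystallization.Theses.PalmUnimodularRigidity.CrysEnergyLimit_holds
  have hEq : (∫ μ, (∫ y, lennardJones ‖y‖ ∂μ) / 2 ∂P) =
      ⨅ Q : PeriodicConfiguration 3, Q.energyPerParticle lennardJones :=
    tendsto_nhds_unique hE (hlim.comp (hψ.comp hφ).tendsto_atTop)
  have hgoodae := hLaws δ hδ P hP hcore hstat hEq.le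
  -- the set of good rooted hard-core configurations has full measure
  set Tset : Set (Measure E3) := {ν |
      ((∀ w w' : E3, ν {w} ≠ 0 → ν {w'} ≠ 0 → w ≠ w' → 55 / 57 + σ ≤ dist w w') ∧
          (∀ w : E3, ν {w} ≠ 0 → w ≠ 0 → (‖w‖ ≤ 1 - σ ∨ 21 / 17 + σ ≤ ‖w‖)) ∧
          ∃ T : Finset E3, T.card = 12 ∧ (∀ w ∈ T, ν {w} ≠ 0 ∧ w ≠ 0 ∧ ‖w‖ ≤ 1 - σ) ∧
            ∀ w : E3, ν {w} ≠ 0 → w ≠ 0 → ‖w‖ ≤ 1 - σ → w ∈ T) ∧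
        ∃ S : Set E3, (0 : E3) ∈ S ∧ (∀ x ∈ S, ∀ y ∈ S, x ≠ y → δ ≤ dist x y) ∧
          ν = (Measure.count : Measure E3).restrict S} with hTset
  have hTae : ∀ᵐ μ ∂P, μ ∈ Tset := hgoodae.and hcore
  have hTc : P Tsetᶜ = 0 := mem_ae_iff.1 hTae
  have hPT : (P Tset).toReal = 1 := by
    rw [measure_congr (ae_eq_univ.2 hTc), measure_univ, ENNReal.toReal_one]
  -- the matching tolerance
  have hmin : 0 < min σ δₓ := lt_min hσ hδₓ
  have hminσ : min σ δₓ ≤ σ := min_le_left _ _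
  have hminδₓ : min σ δₓ ≤ δₓ := min_le_right _ _
  set ε : ℝ := min σ δₓ / 3 with hε_def
  have hε : 0 < ε := by positivity
  have hεσ : 2 * ε ≤ σ := by linarith
  have hεδₓ : 2 * ε < δₓ := by linarith
  have hρ : 1 - η / 2 < (P Tset).toReal := by rw [hPT]; linarith
  -- a large index along `ψ ∘ φ` where `≥ (1 - η/2)·N` particles are matched
  obtain ⟨j, hj, hj1⟩ := ((htransfer Tset 3 ε hε (1 - η / 2) hρ).and
    ((hψ.comp hφ).tendsto_atTop.eventually (eventually_ge_atTop 1))).exists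
  refine false_of_counts hη _ _ hj (hψbad (φ j)) hj1 ?_
  rintro i ⟨ν, hνT, ha, hb⟩
  obtain ⟨hg, hc⟩ := hνT
  exact radialGood_of_matched_measure (x (ψ (φ j))) i hε hεσ hεδₓ
    (fun a b hab => hsepx _ _ (hx _) a b hab) ν hg hc ha hb

end Summit.AtomisticToContinuum.Crystallization.Theorems.RadialDefectsVanishPalmPinnedScale

end
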